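import Summits.AtomisticToContinuum.Crystallization.Theorems.ChessboardParticlePlanesPeriodicWindowsGapSqueezeCompetitor1
import Summits.AtomisticToContinuum.Crystallization.Theorems.PhononSlackCertificatesPeriodicGivenLayeredLayerCake3

/-!
# Crux `PeriodicWindows` (stmt-AtomisticToContinuum-3240), line `dense-laminar-hull` — stub `stub_offsetLayerCake`
# (LC-A): the site energy of a general layered set, layer by layer

For a general layered set `S = B '' {i • v₁(a) + j • v₂(a) + δ m + z m • e₃}` (linear isometry `B` preserving the
height, horizontal offsets `δ`, strictly increasing heights `z` with gaps `≥ 3/4`, spacing `a ≥ 7/10`) the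
Lennard-Jones site energy of the point `p = B (i v₁ + j v₂ + δ m + z m e₃)`,
`∑'_{q ∈ S, q ≠ p} V_LJ (dist p q)`, equals the punctured in-layer sum `inLayerInteraction V_LJ a` plus the sum over
the other layers `m' ≠ m` of the full-layer interactions
`∑'_{(i,j) ∈ ℤ²} V_LJ ‖i v₁ + j v₂ + (δ m' - δ m) + (z m' - z m) e₃‖`, and the latter family is summable over the
layers. The analytic inputs (absolute summability of the in-layer family; absolute summability of the layer
families with `∑ |V_LJ| ≤ C / H⁴` for `|H| ≥ 7/10`, uniformly in the horizontal offset) are hypotheses. This is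
the general-offset analogue of `LayeredHull.cake_siteEnergy` (registry offsets), with the same architecture:
injective parametrisation by `ℤ³` (`gsc_param_injective`, `gsc_range_param`), `tsum_range`, absolute summability
on `ℤ × ℤ × ℤ` by `summable_prod_of_nonneg`, regrouping by `Summable.tsum_prod`, the puncture being free since
`V_LJ 0 = 0`. [folklore]
-/

noncomputable section

namespace Summit.AtomisticToContinuum.Crystallization.Theorems.PeriodicWindowsDenseLaminarHull

open Literature.MathematicalPhysics.StatisticalMechanics Filter Metric
open scoped BigOperators

/-- Gaps `≥ 3/4` in the form `39/50 · (25/26) ≤ z (m+1) - z m` used by the `LayeredHull.cake_*` lemmas.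
[folklore] -/
theorem olc_gap_form (z : ℤ → ℝ) (hgap : ∀ m : ℤ, (3 : ℝ) / 4 ≤ z (m + 1) - z m) (m : ℤ) :
    39 / 50 * (25 / 26 : ℝ) ≤ z (m + 1) - z m := by
  have := hgap m
  norm_num
  linarith

/-- **Summation over the layers** (gaps `≥ 3/4`, any constant): if `|f m'| ≤ C / (z m' - z m)⁴` for `m' ≠ m`, then
`f` is summable over `ℤ` (reduction to `LayeredHull.cake_summable_of_layer_bound` by scaling `f`). [folklore] -/
theorem olc_summable_of_layer_bound (z : ℤ → ℝ) (hgap : ∀ m : ℤ, (3 : ℝ) / 4 ≤ z (m + 1) - z m) (m : ℤ) (C : ℝ)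
    (f : ℤ → ℝ) (hf : ∀ m', m' ≠ m → |f m'| ≤ C / (z m' - z m) ^ 4) : Summable f := by
  have hz' := olc_gap_form z hgap
  obtain ⟨K, hK⟩ : ∃ K : ℝ, K = max C 192 := ⟨_, rfl⟩
  have hKpos : 0 < K := by rw [hK]; exact lt_max_of_lt_right (by norm_num)
  have hCK : C ≤ K := hK ▸ le_max_left _ _
  have hc0 : (0 : ℝ) < 192 / K := by positivity
  refine (summable_mul_left_iff hc0.ne').1 (LayeredHull.cake_summable_of_layer_bound (25 / 26) (by norm_num) z hz'
    m (fun m' => 192 / K * f m') fun m' hm => ?_)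
  have h4 : (0 : ℝ) ≤ (z m' - z m) ^ 4 := by positivity
  rw [abs_mul, abs_of_pos hc0]
  calc 192 / K * |f m'| ≤ 192 / K * (C / (z m' - z m) ^ 4) := mul_le_mul_of_nonneg_left (hf m' hm) hc0.le
    _ ≤ 192 / K * (K / (z m' - z m) ^ 4) :=
        mul_le_mul_of_nonneg_left (div_le_div_of_nonneg_right hCK h4) hc0.le
    _ = 192 / (z m' - z m) ^ 4 := by rw [← mul_div_assoc, div_mul_cancel₀ _ hKpos.ne']

/-- **STUB LC-A: the site energy of a point of a general layered set, layer by layer.** For `a ≥ 7/10`, a linear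
isometry `B` preserving the height, horizontal offsets `δ`, strictly increasing heights `z` with gaps `≥ 3/4`, and
given the absolute summability of the in-layer family and the uniform `C / H⁴` decay of the absolutely summable
layer families (`|H| ≥ 7/10`, horizontal offset arbitrary): the layer interactions seen from layer `m` are summable
over the layers `m' ≠ m`, and the site energy of `B (i v₁ + j v₂ + δ m + z m e₃)` in
`B '' {i v₁ + j v₂ + δ m + z m e₃}` is `inLayerInteraction V_LJ a` plus their sum. [folklore] -/
theorem stub_offsetLayerCake : ∀ a : ℝ, (7 : ℝ) / 10 ≤ a →
    ∀ (B : EuclideanSpace ℝ (Fin 3) ≃ₗᵢ[ℝ] EuclideanSpace ℝ (Fin 3)) (δ : ℤ → EuclideanSpace ℝ (Fin 3)) (z : ℤ → ℝ),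
    (∀ p : EuclideanSpace ℝ (Fin 3), (B p) 2 = p 2) → (∀ m : ℤ, (δ m) 2 = 0) → StrictMono z →
    (∀ m : ℤ, (3 : ℝ) / 4 ≤ z (m + 1) - z m) →
    (Summable fun ij : ℤ × ℤ => |lennardJones ‖((ij.1 : ℝ)) • triangularVec₁ a + ((ij.2 : ℝ)) • triangularVec₂ a‖|) →
    (∃ C : ℝ, ∀ (H : ℝ) (θ : EuclideanSpace ℝ (Fin 3)), θ 2 = 0 → (7 : ℝ) / 10 ≤ |H| →
      (Summable fun ij : ℤ × ℤ => |lennardJones ‖((ij.1 : ℝ)) • triangularVec₁ a + ((ij.2 : ℝ)) • triangularVec₂ a +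
        θ + H • layerNormal 1‖|) ∧
      (∑' ij : ℤ × ℤ, |lennardJones ‖((ij.1 : ℝ)) • triangularVec₁ a + ((ij.2 : ℝ)) • triangularVec₂ a +
        θ + H • layerNormal 1‖|) ≤ C / H ^ 4) →
    ∀ m i j : ℤ,
    (Summable fun m' : ℤ => if m' = m then (0 : ℝ) else
      ∑' ij : ℤ × ℤ, lennardJones ‖((ij.1 : ℝ)) • triangularVec₁ a + ((ij.2 : ℝ)) • triangularVec₂ a +
        (δ m' - δ m) + (z m' - z m) • layerNormal 1‖) ∧
    (∑' q : {q : EuclideanSpace ℝ (Fin 3) // q ∈ (fun p => B p) '' {p | ∃ m i j : ℤ, p = ((i : ℝ) • triangularVec₁ a) +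
        ((j : ℝ) • triangularVec₂ a) + δ m + (z m • layerNormal 1)} ∧ q ≠ B (((i : ℝ) • triangularVec₁ a) +
        ((j : ℝ) • triangularVec₂ a) + δ m + (z m • layerNormal 1))},
      lennardJones (dist (B (((i : ℝ) • triangularVec₁ a) + ((j : ℝ) • triangularVec₂ a) + δ m +
        (z m • layerNormal 1))) (q : EuclideanSpace ℝ (Fin 3)))) =
    inLayerInteraction lennardJones a + ∑' m' : ℤ, if m' = m then (0 : ℝ) else
      ∑' ij : ℤ × ℤ, lennardJones ‖((ij.1 : ℝ)) • triangularVec₁ a + ((ij.2 : ℝ)) • triangularVec₂ a +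
        (δ m' - δ m) + (z m' - z m) • layerNormal 1‖ := by
  intro a ha B δ z hB hδ hz hgap hin hlay m i j
  obtain ⟨C, hC⟩ := hlay
  have ha0 : 0 < a := by linarith
  have hz' := olc_gap_form z hgap
  -- the parametrisation of the layered set by `ℤ × ℤ × ℤ`
  obtain ⟨P, hPdef⟩ : ∃ P : ℤ × ℤ × ℤ → EuclideanSpace ℝ (Fin 3), P = fun t => B (((t.2.1 : ℝ)) • triangularVec₁ a +
      ((t.2.2 : ℝ)) • triangularVec₂ a + δ t.1 + z t.1 • layerNormal 1) := ⟨_, rfl⟩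
  have hP : ∀ m' i' j' : ℤ, P (m', i', j') = B (((i' : ℝ)) • triangularVec₁ a + ((j' : ℝ)) • triangularVec₂ a +
      δ m' + z m' • layerNormal 1) := fun m' i' j' => by rw [hPdef]
  have hinj : Function.Injective P := by
    rw [hPdef]; exact gsc_param_injective ha0 hB hδ hz.injective
  have hS : Set.range P = (fun p => B p) '' {p | ∃ m i j : ℤ, p = ((i : ℝ) • triangularVec₁ a) +
      ((j : ℝ) • triangularVec₂ a) + δ m + (z m • layerNormal 1)} := by
    rw [hPdef]; exact gsc_range_param B δ z
  -- the layer families seen from layer `m`, and the translated family on `ℤ × ℤ × ℤ`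
  obtain ⟨g, hg⟩ : ∃ g : ℤ → ℤ × ℤ → ℝ, ∀ m' ij, g m' ij = lennardJones ‖((ij.1 : ℝ)) • triangularVec₁ a +
      ((ij.2 : ℝ)) • triangularVec₂ a + (δ m' - δ m) + (z m' - z m) • layerNormal 1‖ := ⟨_, fun _ _ => rfl⟩
  obtain ⟨F, hF⟩ : ∃ F : ℤ × ℤ × ℤ → ℝ, ∀ t, F t = g t.1 (t.2.1 - i, t.2.2 - j) := ⟨_, fun _ => rfl⟩
  have htg : ∀ m' : ℤ, (∑' ij : ℤ × ℤ, lennardJones ‖((ij.1 : ℝ)) • triangularVec₁ a +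
      ((ij.2 : ℝ)) • triangularVec₂ a + (δ m' - δ m) + (z m' - z m) • layerNormal 1‖) = ∑' ij : ℤ × ℤ, g m' ij :=
    fun m' => tsum_congr fun ij => (hg m' ij).symm
  have hFg : ∀ (m' : ℤ) (ij : ℤ × ℤ), F (m', ij) = g m' (Equiv.subRight ((i, j) : ℤ × ℤ) ij) := fun m' ij => by
    rw [hF]; rfl
  -- pair interactions seen from the site `P (m, i, j)`
  have hfe : ∀ t : ℤ × ℤ × ℤ, lennardJones (dist (P (m, i, j)) (P t)) = F t := by
    rintro ⟨m', i', j'⟩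
    rw [hF, hg, hP, hP, LinearIsometryEquiv.dist_map, dist_comm, dist_eq_norm]
    dsimp only
    push_cast
    congr 2
    module
  -- the slices `m' ≠ m`: absolutely summable with `∑ |·| ≤ C / (z m' - z m)⁴`
  have hslice : ∀ m' : ℤ, m' ≠ m →
      (Summable fun ij : ℤ × ℤ => |g m' ij|) ∧ ∑' ij : ℤ × ℤ, |g m' ij| ≤ C / (z m' - z m) ^ 4 := by
    intro m' hm
    have hH : (7 : ℝ) / 10 ≤ |z m' - z m| := LayeredHull.cake_height_sep (25 / 26) (by norm_num) z hz' hm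
    have hθ : (δ m' - δ m) 2 = 0 := by rw [PiLp.sub_apply, hδ, hδ, sub_zero]
    obtain ⟨h1, h2⟩ := hC (z m' - z m) (δ m' - δ m) hθ hH
    exact ⟨h1.congr fun ij => (congrArg abs (hg m' ij)).symm,
      (tsum_congr fun ij => congrArg abs (hg m' ij)).trans_le h2⟩
  -- the slice `m' = m`: the in-layer family
  have hgm : ∀ ij : ℤ × ℤ, g m ij =
      lennardJones ‖((ij.1 : ℝ)) • triangularVec₁ a + ((ij.2 : ℝ)) • triangularVec₂ a‖ := fun ij => by
    rw [hg, sub_self, sub_self, zero_smul, add_zero, add_zero]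
  have hslice_m : Summable fun ij : ℤ × ℤ => |g m ij| := hin.congr fun ij => by rw [hgm]
  have habsg : ∀ m' : ℤ, Summable fun ij : ℤ × ℤ => |g m' ij| := fun m' => by
    by_cases hm : m' = m
    · rw [hm]; exact hslice_m
    · exact (hslice m' hm).1
  -- absolute summability on `ℤ × ℤ × ℤ`
  have habs_slice : ∀ m' : ℤ, Summable fun ij : ℤ × ℤ => |F (m', ij)| := fun m' =>
    ((Equiv.subRight ((i, j) : ℤ × ℤ)).summable_iff.2 (habsg m')).congr fun ij => by
      rw [Function.comp_apply, hFg]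
  have habs_tsum : ∀ m' : ℤ, ∑' ij : ℤ × ℤ, |F (m', ij)| = ∑' ij : ℤ × ℤ, |g m' ij| := fun m' =>
    (tsum_congr fun ij => congrArg abs (hFg m' ij)).trans
      (Equiv.tsum_eq (Equiv.subRight ((i, j) : ℤ × ℤ)) fun ij => |g m' ij|)
  have hFabs : Summable fun t : ℤ × ℤ × ℤ => |F t| := by
    rw [summable_prod_of_nonneg fun _ => abs_nonneg _]
    refine ⟨habs_slice, olc_summable_of_layer_bound z hgap m C _ fun m' hm => ?_⟩
    rw [abs_of_nonneg (tsum_nonneg fun _ => abs_nonneg _), habs_tsum]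
    exact (hslice m' hm).2
  have hFsum : Summable F := hFabs.of_abs
  -- inner sums
  have hinner : ∀ m' : ℤ, ∑' ij : ℤ × ℤ, F (m', ij) = ∑' ij : ℤ × ℤ, g m' ij := fun m' =>
    (tsum_congr fun ij => hFg m' ij).trans (Equiv.tsum_eq (Equiv.subRight ((i, j) : ℤ × ℤ)) (g m'))
  have hself : ∑' ij : ℤ × ℤ, g m ij = inLayerInteraction lennardJones a := by
    unfold inLayerInteraction
    refine tsum_congr fun ij => ?_
    rw [hgm]
    split_ifs with h0
    · rw [h0]
      simp [lennardJones_zero]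
    · rfl
  -- summability over the layers of the layer interactions
  have hlayers : Summable fun m' : ℤ => if m' = m then (0 : ℝ) else ∑' ij : ℤ × ℤ, g m' ij := by
    refine olc_summable_of_layer_bound z hgap m C _ fun m' hm => ?_
    rw [if_neg hm]
    obtain ⟨h1, h2⟩ := hslice m' hm
    have h3 : ‖∑' ij : ℤ × ℤ, g m' ij‖ ≤ ∑' ij : ℤ × ℤ, ‖g m' ij‖ :=
      norm_tsum_le_tsum_norm (by simpa only [Real.norm_eq_abs] using h1)
    simp only [Real.norm_eq_abs] at h3
    exact h3.trans h2
  have h0 : lennardJones (dist (P (m, i, j)) (P (m, i, j))) = 0 := by rw [dist_self, lennardJones_zero]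
  -- assemble
  refine ⟨hlayers.congr fun m' => ?_, ?_⟩
  · show (if m' = m then (0 : ℝ) else ∑' ij : ℤ × ℤ, g m' ij) = _
    rw [htg]
  rw [← hS, ← hP m i j]
  calc ∑' q : {q : EuclideanSpace ℝ (Fin 3) // q ∈ Set.range P ∧ q ≠ P (m, i, j)},
      lennardJones (dist (P (m, i, j)) (q : EuclideanSpace ℝ (Fin 3)))
      = ∑' q : Set.range P, lennardJones (dist (P (m, i, j)) (q : EuclideanSpace ℝ (Fin 3))) :=
        LayeredHull.cake_tsum_subtype_ne_eq (fun q => lennardJones (dist (P (m, i, j)) q)) _ _ h0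
    _ = ∑' t : ℤ × ℤ × ℤ, lennardJones (dist (P (m, i, j)) (P t)) :=
        tsum_range (fun q => lennardJones (dist (P (m, i, j)) q)) hinj
    _ = ∑' t : ℤ × ℤ × ℤ, F t := tsum_congr hfe
    _ = ∑' (m' : ℤ) (ij : ℤ × ℤ), F (m', ij) := hFsum.tsum_prod
    _ = ∑' m' : ℤ, ∑' ij : ℤ × ℤ, g m' ij := tsum_congr hinner
    _ = inLayerInteraction lennardJones a + ∑' m' : ℤ, (if m' = m then (0 : ℝ) else ∑' ij : ℤ × ℤ, g m' ij) :=
        LayeredHull.cake_tsum_eq_add_tsum_ite _ m _ hself hlayers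
    _ = _ := by
        congr 1
        exact tsum_congr fun m' => by rw [htg]

end Summit.AtomisticToContinuum.Crystallization.Theorems.PeriodicWindowsDenseLaminarHull

end
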